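import Mathlib
import HarnessLib
import Summits.ValiantsHypothesis.ValiantsHypothesis.Theorems.LacunarySymmetroidMatrixDescartesOsculationLawGPArcSheets
import Summits.ValiantsHypothesis.ValiantsHypothesis.Theorems.LacunarySymmetroidMatrixDescartesOsculationLawGPArcPencilCoprime

/-!
# ValiantsHypothesis / LacunarySymmetroid — crux `MatrixDescartes` (stmt-ValiantsHypothesis-18050, V1),
# line `Cruxes/MatrixDescartes/Lines/osculation_law.lean` («osculation-law»), stub `stub_recursion`, general position (ROUTE′):
# NODE-2 SHEETS ON THE ARC `b = t^N` — finitely many bad shifts (service block for (a2) = `arc1_cofinite`, bus l.8291/l.8302)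

At node 2 of the recursion, for the generic DIAGONAL witness, the (congruence-normalised) node curve at the witness end of a
segment is a product of SHEETS
`L_i(C) = C (C − s_i)·X₁ + ι(−(G_i + C (C − s_i)·X^N))`
(`G_i = Σ_{l ≤ j} σ_{l,i} t^{d_l}` the full slot fewnomial, `s_i = σ_{j,i}`, `N = d_j`, `C` the shift; val-lit-p7 g13, bus l.8291).
On the arc `b = 1·t^N` the shift CANCELS in the sheet (`arc(L_i(C)) = −G_i`), and the sheet's bordered log-Hessian restricts to
`C (C − s_i)·X^N·((θG_i)² + C (C − s_i)·X^N·(2N·θG_i − θ²G_i))`, `θ = t·d/dt` — LINEAR in the parameter `C − s_i`.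

* `X_mul_derivative_neg_add_C_mul_X_pow`, `…_two` — Euler derivatives of `−(G + C a·X^N)`.
* `node_two_hessian_factor` — the identity `C a X^N·θ²g' + (θg')² = (θG)² + C a·X^N·(2N·θG − θ²G)` for `g' = −(G + C a X^N)`.
* `arc_sheet_node_two`, `arc_logHessian_sheet_node_two` — the two restrictions to the arc (over p7's `arc_sheet` /
  `arc_logHessian_sheet`).
* `isCoprime_X_pow_of_eval_zero_ne`, `isCoprime_theta_sq` — `G(0) ≠ 0 ⇒ G ⟂ X^N`; `G(0) ≠ 0 ∧ G separable ⇒ (θG)² ⟂ G`.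
* `isCoprime_arc_sheet_node_two` — `a ≠ 0`, `G(0) ≠ 0`, `G ⟂ (θG)² + C a X^N (2NθG − θ²G)` ⇒ `arc(L) ⟂ arc(H L)`.
* `finite_setOf_not_isCoprime_node_two_factor` — for `G` separable with `G(0) ≠ 0` the last condition fails for finitely many
  `C` only (`finite_setOf_not_isCoprime_linear_sub`, p636802).
* ★ `finite_bad_shift_arc_node_two` — for a finite family `G_i` (each separable, `G_i(0) ≠ 0`, pairwise coprime — p6 g14's
  `separable_and_isCoprime_of_prod` on the witness's separability conjunct) the set of shifts `C` at which
  `arc(Π_i L_i(C))` is NOT coprime to `arc(H(Π_i L_i(C)))` is finite (⊆ `{s_i}` ∪ the finitely many bad `C` of each factor;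
  assembled by p7's `isCoprime_arc_logHessian_prod` at arc coefficient `1`).

Honest framing: algebraic LEMMAS toward the OPEN stub `stub_recursion` (its density residue, clause (a2)); nothing of the
summit is proved; `VP ≠ VNP` is NOT proved.  No definitions, no named facts.
-/

-- `Summit.ValiantsHypothesis.ValiantsHypothesis.…` is the tree's mandated single-conjunct layout (Sub = Summit).
set_option linter.dupNamespace false

noncomputable section

namespace Summit.ValiantsHypothesis.ValiantsHypothesis.Theorems.LacunarySymmetroidMatrixDescartes

open Polynomial

namespace OsculationGeneric

/-! ### Euler derivatives of the node-2 sheet polynomial `g' = −(G + C a·X^N)` -/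

/-- `θ(X^N) = N·X^N` for `θ = X·d/dX`. [folklore] -/
theorem X_mul_derivative_X_pow' (N : ℕ) : (X : ℝ[X]) * derivative (X ^ N) = Polynomial.C (N : ℝ) * X ^ N := by
  rcases Nat.eq_zero_or_pos N with rfl | hN
  · simp
  · rw [derivative_X_pow]
    obtain ⟨k, rfl⟩ := Nat.exists_eq_succ_of_ne_zero hN.ne'
    rw [Nat.succ_sub_one, pow_succ]
    ring

/-- `θ(−(G + C a X^N)) = −(θG + C (a N) X^N)`. [folklore] -/
theorem X_mul_derivative_neg_add_C_mul_X_pow (G : ℝ[X]) (a : ℝ) (N : ℕ) :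
    (X : ℝ[X]) * derivative (-(G + Polynomial.C a * X ^ N)) = -(X * derivative G + Polynomial.C (a * N) * X ^ N) := by
  rw [derivative_neg, derivative_add, derivative_C_mul, mul_neg, mul_add, ← mul_assoc, mul_comm X (Polynomial.C a), mul_assoc,
    X_mul_derivative_X_pow', map_mul]
  ring

/-- `θ²(−(G + C a X^N)) = −(θ²G + C (a N²) X^N)`. [folklore] -/
theorem X_mul_derivative_neg_add_C_mul_X_pow_two (G : ℝ[X]) (a : ℝ) (N : ℕ) :
    (X : ℝ[X]) * derivative (X * derivative (-(G + Polynomial.C a * X ^ N))) =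
      -(X * derivative (X * derivative G) + Polynomial.C (a * N ^ 2) * X ^ N) := by
  rw [X_mul_derivative_neg_add_C_mul_X_pow, X_mul_derivative_neg_add_C_mul_X_pow]
  simp only [Polynomial.C_mul, Polynomial.C_pow]
  ring

/-- **The node-2 Hessian factor is linear in the parameter**: for `g' = −(G + C a X^N)`,
`C a X^N·θ²g' + (θg')² = (θG)² + C a·X^N·(2N·θG − θ²G)`. [folklore] -/
theorem node_two_hessian_factor (G : ℝ[X]) (a : ℝ) (N : ℕ) :
    Polynomial.C a * X ^ N * (X * derivative (X * derivative (-(G + Polynomial.C a * X ^ N))))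
        + (X * derivative (-(G + Polynomial.C a * X ^ N))) ^ 2 =
      (X * derivative G) ^ 2
        + Polynomial.C a * (X ^ N * (Polynomial.C (2 * (N : ℝ)) * (X * derivative G) - X * derivative (X * derivative G))) := by
  rw [X_mul_derivative_neg_add_C_mul_X_pow_two, X_mul_derivative_neg_add_C_mul_X_pow]
  simp only [Polynomial.C_mul, Polynomial.C_pow, Polynomial.C_ofNat]
  ring

/-! ### The node-2 sheet and its log-Hessian restricted to the arc `b = 1·t^N` -/

/-- On the arc `b = 1·t^N` the shift cancels: `arc(C a·X₁ + ι(−(G + C a X^N))) = −G`. [folklore] -/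
theorem arc_sheet_node_two (G : ℝ[X]) (a : ℝ) (N : ℕ) :
    MvPolynomial.aeval (![Polynomial.X, Polynomial.C 1 * Polynomial.X ^ N] : Fin 2 → ℝ[X])
        (MvPolynomial.C a * MvPolynomial.X 1 +
          Polynomial.aeval (MvPolynomial.X 0 : MvPolynomial (Fin 2) ℝ) (-(G + Polynomial.C a * X ^ N))) = -G := by
  rw [arc_sheet, mul_one]
  ring

/-- On the arc `b = 1·t^N` the sheet's bordered log-Hessian is `C a X^N·((θG)² + C a X^N (2NθG − θ²G))`. [folklore] -/
theorem arc_logHessian_sheet_node_two (G : ℝ[X]) (a : ℝ) (N : ℕ) :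
    MvPolynomial.aeval (![Polynomial.X, Polynomial.C 1 * Polynomial.X ^ N] : Fin 2 → ℝ[X])
        (MvPolynomial.X 0 * MvPolynomial.pderiv 0 (MvPolynomial.X 0 * MvPolynomial.pderiv 0 (MvPolynomial.C a * MvPolynomial.X 1 + Polynomial.aeval (MvPolynomial.X 0 : MvPolynomial (Fin 2) ℝ) (-(G + Polynomial.C a * X ^ N))))
            * (MvPolynomial.X 1 * MvPolynomial.pderiv 1 (MvPolynomial.C a * MvPolynomial.X 1 + Polynomial.aeval (MvPolynomial.X 0 : MvPolynomial (Fin 2) ℝ) (-(G + Polynomial.C a * X ^ N)))) ^ 2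
          - 2 * (MvPolynomial.X 0 * MvPolynomial.pderiv 0 (MvPolynomial.X 1 * MvPolynomial.pderiv 1 (MvPolynomial.C a * MvPolynomial.X 1 + Polynomial.aeval (MvPolynomial.X 0 : MvPolynomial (Fin 2) ℝ) (-(G + Polynomial.C a * X ^ N)))))
            * (MvPolynomial.X 0 * MvPolynomial.pderiv 0 (MvPolynomial.C a * MvPolynomial.X 1 + Polynomial.aeval (MvPolynomial.X 0 : MvPolynomial (Fin 2) ℝ) (-(G + Polynomial.C a * X ^ N)))) * (MvPolynomial.X 1 * MvPolynomial.pderiv 1 (MvPolynomial.C a * MvPolynomial.X 1 + Polynomial.aeval (MvPolynomial.X 0 : MvPolynomial (Fin 2) ℝ) (-(G + Polynomial.C a * X ^ N))))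
          + MvPolynomial.X 1 * MvPolynomial.pderiv 1 (MvPolynomial.X 1 * MvPolynomial.pderiv 1 (MvPolynomial.C a * MvPolynomial.X 1 + Polynomial.aeval (MvPolynomial.X 0 : MvPolynomial (Fin 2) ℝ) (-(G + Polynomial.C a * X ^ N))))
            * (MvPolynomial.X 0 * MvPolynomial.pderiv 0 (MvPolynomial.C a * MvPolynomial.X 1 + Polynomial.aeval (MvPolynomial.X 0 : MvPolynomial (Fin 2) ℝ) (-(G + Polynomial.C a * X ^ N)))) ^ 2) =
      Polynomial.C a * X ^ N *
        ((X * derivative G) ^ 2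
          + Polynomial.C a * (X ^ N * (Polynomial.C (2 * (N : ℝ)) * (X * derivative G) - X * derivative (X * derivative G)))) := by
  rw [arc_logHessian_sheet, mul_one, node_two_hessian_factor]

/-! ### Coprimality of one sheet with its log-Hessian on the arc -/

/-- `G(0) ≠ 0 ⇒ G ⟂ X^N`. [folklore] -/
theorem isCoprime_X_pow_of_eval_zero_ne (G : ℝ[X]) (hG0 : G.eval 0 ≠ 0) (N : ℕ) : IsCoprime G ((X : ℝ[X]) ^ N) := by
  refine Irreducible.coprime_pow_of_not_dvd N irreducible_X ?_
  rw [X_dvd_iff, coeff_zero_eq_eval_zero]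
  exact hG0

/-- `G(0) ≠ 0` and `G` separable ⇒ `(θG)² ⟂ G`. [folklore] -/
theorem isCoprime_theta_sq (G : ℝ[X]) (hG0 : G.eval 0 ≠ 0) (hsep : G.Separable) :
    IsCoprime ((X * derivative G) ^ 2) G := by
  have hX : IsCoprime (X : ℝ[X]) G := by
    simpa using (isCoprime_X_pow_of_eval_zero_ne G hG0 1).symm
  have hd : IsCoprime (derivative G) G := ((separable_def G).1 hsep).symm
  exact (hX.mul_left hd).pow_left

/-- **One sheet against its own log-Hessian on the arc.**  If `a ≠ 0`, `G(0) ≠ 0` and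
`G ⟂ (θG)² + C a·X^N·(2N·θG − θ²G)`, then `arc(L) ⟂ arc(H(L))` for the node-2 sheet `L = C a·X₁ + ι(−(G + C a X^N))`.
[folklore] -/
theorem isCoprime_arc_sheet_node_two (G : ℝ[X]) (a : ℝ) (N : ℕ) (ha : a ≠ 0) (hG0 : G.eval 0 ≠ 0)
    (hQ : IsCoprime G ((X * derivative G) ^ 2
          + Polynomial.C a * (X ^ N * (Polynomial.C (2 * (N : ℝ)) * (X * derivative G) - X * derivative (X * derivative G))))) :
    IsCoprime
      (MvPolynomial.aeval (![Polynomial.X, Polynomial.C 1 * Polynomial.X ^ N] : Fin 2 → ℝ[X])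
        (MvPolynomial.C a * MvPolynomial.X 1 +
          Polynomial.aeval (MvPolynomial.X 0 : MvPolynomial (Fin 2) ℝ) (-(G + Polynomial.C a * X ^ N))))
      (MvPolynomial.aeval (![Polynomial.X, Polynomial.C 1 * Polynomial.X ^ N] : Fin 2 → ℝ[X])
        (MvPolynomial.X 0 * MvPolynomial.pderiv 0 (MvPolynomial.X 0 * MvPolynomial.pderiv 0 (MvPolynomial.C a * MvPolynomial.X 1 + Polynomial.aeval (MvPolynomial.X 0 : MvPolynomial (Fin 2) ℝ) (-(G + Polynomial.C a * X ^ N))))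
            * (MvPolynomial.X 1 * MvPolynomial.pderiv 1 (MvPolynomial.C a * MvPolynomial.X 1 + Polynomial.aeval (MvPolynomial.X 0 : MvPolynomial (Fin 2) ℝ) (-(G + Polynomial.C a * X ^ N)))) ^ 2
          - 2 * (MvPolynomial.X 0 * MvPolynomial.pderiv 0 (MvPolynomial.X 1 * MvPolynomial.pderiv 1 (MvPolynomial.C a * MvPolynomial.X 1 + Polynomial.aeval (MvPolynomial.X 0 : MvPolynomial (Fin 2) ℝ) (-(G + Polynomial.C a * X ^ N)))))
            * (MvPolynomial.X 0 * MvPolynomial.pderiv 0 (MvPolynomial.C a * MvPolynomial.X 1 + Polynomial.aeval (MvPolynomial.X 0 : MvPolynomial (Fin 2) ℝ) (-(G + Polynomial.C a * X ^ N)))) * (MvPolynomial.X 1 * MvPolynomial.pderiv 1 (MvPolynomial.C a * MvPolynomial.X 1 + Polynomial.aeval (MvPolynomial.X 0 : MvPolynomial (Fin 2) ℝ) (-(G + Polynomial.C a * X ^ N))))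
          + MvPolynomial.X 1 * MvPolynomial.pderiv 1 (MvPolynomial.X 1 * MvPolynomial.pderiv 1 (MvPolynomial.C a * MvPolynomial.X 1 + Polynomial.aeval (MvPolynomial.X 0 : MvPolynomial (Fin 2) ℝ) (-(G + Polynomial.C a * X ^ N))))
            * (MvPolynomial.X 0 * MvPolynomial.pderiv 0 (MvPolynomial.C a * MvPolynomial.X 1 + Polynomial.aeval (MvPolynomial.X 0 : MvPolynomial (Fin 2) ℝ) (-(G + Polynomial.C a * X ^ N)))) ^ 2)) := by
  rw [arc_sheet_node_two, arc_logHessian_sheet_node_two]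
  refine IsCoprime.neg_left ?_
  have hu : IsUnit (Polynomial.C a) := Polynomial.isUnit_C.2 (Ne.isUnit ha)
  rw [mul_assoc, isCoprime_mul_unit_left_right hu]
  exact (isCoprime_X_pow_of_eval_zero_ne G hG0 N).mul_right hQ

/-- **Finitely many bad shifts for one factor.**  For `G` separable with `G(0) ≠ 0`, the coprimality
`G ⟂ (θG)² + C (C − s)·X^N·(2N·θG − θ²G)` fails for finitely many real `C` only. [folklore] -/
theorem finite_setOf_not_isCoprime_node_two_factor (G : ℝ[X]) (s : ℝ) (N : ℕ) (hG0 : G.eval 0 ≠ 0) (hsep : G.Separable) :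
    {C : ℝ | ¬ IsCoprime G ((X * derivative G) ^ 2
          + Polynomial.C (C - s) * (X ^ N * (Polynomial.C (2 * (N : ℝ)) * (X * derivative G) - X * derivative (X * derivative G))))}.Finite := by
  have hG : G ≠ 0 := by
    rintro rfl
    exact hG0 (eval_zero)
  refine (finite_setOf_not_isCoprime_linear_sub G ((X * derivative G) ^ 2)
    (X ^ N * (Polynomial.C (2 * (N : ℝ)) * (X * derivative G) - X * derivative (X * derivative G))) s hG
    (Or.inl (isCoprime_theta_sq G hG0 hsep))).subset fun C hC h => hC h.symm

/-! ### The product of the node-2 sheets on the arc -/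

/-- **Finitely many bad shifts at node 2 (arc `b = t^N`, witness end).**  Let `G_i` be separable, pairwise coprime real
polynomials with `G_i(0) ≠ 0` (the slot fewnomials of the generic diagonal witness through level `j`; p6 g14's
`separable_and_isCoprime_of_prod`), `s_i` reals and `N : ℕ`.  Then for all but finitely many shifts `C` the restriction to
the arc `b = 1·t^N` of the product of the node-2 sheets `L_i(C) = C (C − s_i)·X₁ + ι(−(G_i + C (C − s_i) X^N))` is coprime to
the restriction of its bordered log-Hessian (p7 g13's `isCoprime_arc_logHessian_prod`). [folklore] -/
theorem finite_bad_shift_arc_node_two {ι : Type*} [Fintype ι] [DecidableEq ι] (G : ι → ℝ[X]) (s : ι → ℝ) (N : ℕ)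
    (hsep : ∀ i, (G i).Separable) (hcop : ∀ i i', i ≠ i' → IsCoprime (G i) (G i')) (hG0 : ∀ i, (G i).eval 0 ≠ 0) :
    {C : ℝ | ¬ IsCoprime
      (MvPolynomial.aeval (![Polynomial.X, Polynomial.C 1 * Polynomial.X ^ N] : Fin 2 → ℝ[X])
        (∏ i, (MvPolynomial.C (C - s i) * MvPolynomial.X 1 +
          Polynomial.aeval (MvPolynomial.X 0 : MvPolynomial (Fin 2) ℝ) (-(G i + Polynomial.C (C - s i) * X ^ N)))))
      (MvPolynomial.aeval (![Polynomial.X, Polynomial.C 1 * Polynomial.X ^ N] : Fin 2 → ℝ[X])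
        (MvPolynomial.X 0 * MvPolynomial.pderiv 0 (MvPolynomial.X 0 * MvPolynomial.pderiv 0 (∏ i, (MvPolynomial.C (C - s i) * MvPolynomial.X 1 + Polynomial.aeval (MvPolynomial.X 0 : MvPolynomial (Fin 2) ℝ) (-(G i + Polynomial.C (C - s i) * X ^ N)))))
            * (MvPolynomial.X 1 * MvPolynomial.pderiv 1 (∏ i, (MvPolynomial.C (C - s i) * MvPolynomial.X 1 + Polynomial.aeval (MvPolynomial.X 0 : MvPolynomial (Fin 2) ℝ) (-(G i + Polynomial.C (C - s i) * X ^ N))))) ^ 2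
          - 2 * (MvPolynomial.X 0 * MvPolynomial.pderiv 0 (MvPolynomial.X 1 * MvPolynomial.pderiv 1 (∏ i, (MvPolynomial.C (C - s i) * MvPolynomial.X 1 + Polynomial.aeval (MvPolynomial.X 0 : MvPolynomial (Fin 2) ℝ) (-(G i + Polynomial.C (C - s i) * X ^ N))))))
            * (MvPolynomial.X 0 * MvPolynomial.pderiv 0 (∏ i, (MvPolynomial.C (C - s i) * MvPolynomial.X 1 + Polynomial.aeval (MvPolynomial.X 0 : MvPolynomial (Fin 2) ℝ) (-(G i + Polynomial.C (C - s i) * X ^ N))))) * (MvPolynomial.X 1 * MvPolynomial.pderiv 1 (∏ i, (MvPolynomial.C (C - s i) * MvPolynomial.X 1 + Polynomial.aeval (MvPolynomial.X 0 : MvPolynomial (Fin 2) ℝ) (-(G i + Polynomial.C (C - s i) * X ^ N)))))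
          + MvPolynomial.X 1 * MvPolynomial.pderiv 1 (MvPolynomial.X 1 * MvPolynomial.pderiv 1 (∏ i, (MvPolynomial.C (C - s i) * MvPolynomial.X 1 + Polynomial.aeval (MvPolynomial.X 0 : MvPolynomial (Fin 2) ℝ) (-(G i + Polynomial.C (C - s i) * X ^ N)))))
            * (MvPolynomial.X 0 * MvPolynomial.pderiv 0 (∏ i, (MvPolynomial.C (C - s i) * MvPolynomial.X 1 + Polynomial.aeval (MvPolynomial.X 0 : MvPolynomial (Fin 2) ℝ) (-(G i + Polynomial.C (C - s i) * X ^ N))))) ^ 2))}.Finite := by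
  classical
  -- the finite exceptional set: the diagonal values `s i` and the bad shifts of each factor
  set F : Set ℝ := Set.range s ∪ ⋃ i, {C : ℝ | ¬ IsCoprime (G i) ((X * derivative (G i)) ^ 2
          + Polynomial.C (C - s i) * (X ^ N * (Polynomial.C (2 * (N : ℝ)) * (X * derivative (G i)) - X * derivative (X * derivative (G i)))))}
    with hF
  have hFfin : F.Finite :=
    (Set.finite_range s).union (Set.finite_iUnion fun i => finite_setOf_not_isCoprime_node_two_factor (G i) (s i) N (hG0 i) (hsep i))
  refine hFfin.subset fun C hC => ?_
  -- outside `F` the product is coprime to its log-Hessian on the arc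
  by_contra hCF
  apply hC
  refine isCoprime_arc_logHessian_prod Finset.univ
    (fun i => MvPolynomial.C (C - s i) * MvPolynomial.X 1 +
      Polynomial.aeval (MvPolynomial.X 0 : MvPolynomial (Fin 2) ℝ) (-(G i + Polynomial.C (C - s i) * X ^ N))) 1 N ?_ ?_
  · -- pairwise: `arc(L_i) = −G_i`
    intro i _ i' _ hii'
    rw [arc_sheet_node_two, arc_sheet_node_two]
    exact (hcop i i' hii').neg_neg
  · -- self: each sheet against its own log-Hessian
    intro i _
    refine isCoprime_arc_sheet_node_two (G i) (C - s i) N ?_ (hG0 i) ?_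
    · intro h0
      exact hCF (Or.inl ⟨i, (sub_eq_zero.1 h0).symm⟩)
    · by_contra hQ
      exact hCF (Or.inr (Set.mem_iUnion.2 ⟨i, hQ⟩))

end OsculationGeneric

end Summit.ValiantsHypothesis.ValiantsHypothesis.Theorems.LacunarySymmetroidMatrixDescartes

end
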